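import Summits.CriticalPhenomena.PercolationContinuityZ3.Theorems.PercNearOneGluingNoHeavyLowerTailKnQuestion8CoefficientwiseCoreClassKernelMixShortThreadPrep
import HarnessLib

/-!
# IET on every 3-thread bundle with a thread of length 2 — Θ(2, m, n), ALL monotone real levels, every up-closed event

Support file (`--supports stmt-CriticalPhenomena-4575`, closed), prover `prim-cplus-coupling` (gen 53).  No definitions, no notations, no named facts,
no sorries; standard axioms.  Memo `prim-cplus-coupling/A5-COUPLING-gen53.md` §1 (THEOREM A 'thread slicing', case ℓ = 2, and COROLLARY B for r = 3).

THE ARGUMENT (memo §1.1–1.3).  Let the short thread be `u – wᵥ – b` with edges `f = e t₀ 1`, `g = e t₀ 2`, and let `E′ = A p ∪ A q` be the edge set of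
the cycle formed by the two other threads.  Split `Σ_{ω ⊆ E}` according to the colours of `f, g`:
* `f, g` blue resp. `f, g` red: the short thread is fully blue resp. fully red, so these colourings carry only demand resp. only supply, and together
  they form exactly the functional of THEOREM BI (`iet_boundary_bundle`, O = {f, g});
* `f` red, `g` blue (`ω = η + f`, `η ⊆ E′`): `C_u(η + f) = C′_u(η) ∪ {wᵥ}` and `C_u(E ∖ (η+f)) = C_u((E′∖η) + g) = C′_u(E′∖η) ∪ {wᵥ : b ∈ C′_u(E′∖η)}`
  (`cluster_insert_hubEdge_u/b`), so this part is the IET functional of the CYCLE for the event `η ↦ 𝒱(η+f)` and all six levels precomposed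
  with `S ↦ S ∪ {wᵥ}` — nonnegative by `iet_cycle`;
* `f` blue, `g` red: symmetrically, the cycle functional for `η ↦ 𝒱(η+g)` with `h, k, hᵇ, kᵇ` precomposed with `S ↦ S ∪ {wᵥ}` and `hᵃ, kᵃ` unchanged.
THEOREM `Coefficientwise.iet_bundle_shortThread`: for every explicit bundle with exactly three threads `p, q, t₀`, `L t₀ = 2`, every up-closed `𝒱` and all
monotone real levels `0 ≤ hᵃ, hᵇ ≤ h`, `0 ≤ kᵃ, kᵇ ≤ k`, the IET sum `Σ_{𝒱, b∈X∖Y} h(X)k(X) + Σ_{𝒱, b∈Y∖X} (hᵃX − hᵇY)(kᵃX − kᵇY)` is `≥ 0`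
(hypotheses literally those of `iet_boundary_bundle` plus `L t₀ = 2` and 'no fourth thread').  This is CONJECTURE IET for the bundles Θ(2, m, n), all
m, n ≥ 1, with NO thread-support or regime hypothesis on the levels — the first general-level case with three threads beyond Θ(1, m, n).
[cite: KozmaNitzan2024, Questions 8–9 (§5.5 p. 36) (context); Harris 1960]
-/

namespace Summit.CriticalPhenomena.PercolationContinuityZ3.Theorems

open Finset Literature.Probability.Percolation

namespace Coefficientwise

variable {ι V : Type*}

open Classical in
/-- **THEOREM (IET on Θ(2, m, n), all monotone real levels).**  On an explicit bundle with exactly three threads `p, q, t₀` where `L t₀ = 2`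
(hypotheses as in `iet_boundary_bundle` plus `L t₀ = 2` and 'every thread is `p`, `q` or `t₀`'), for EVERY up-closed event `𝒱` and all monotone
`h, k`, `0 ≤ hᵃ, hᵇ ≤ h`, `0 ≤ kᵃ, kᵇ ≤ k`:
`0 ≤ Σ_{ω ⊆ E : 𝒱 ω, b ∈ X∖Y} h(X) k(X) + Σ_{ω ⊆ E : 𝒱 ω, b ∈ Y∖X} (hᵃX − hᵇY)(kᵃX − kᵇY)`, `X = C_u(ω)`, `Y = C_u(E∖ω)`.
Proof: slice by the two edges of the short thread; boundary slices = `iet_boundary_bundle`; mixed slices = `iet_cycle` with shifted levels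
(module docstring).  [cite: KozmaNitzan2024, Questions 8–9 (§5.5 p. 36) (context); Harris 1960] -/
theorem iet_bundle_shortThread (ends : ι → Sym2 V) (r : ℕ) (L : ℕ → ℕ) (hL : ∀ t, t < r → 1 ≤ L t)
    (w : ℕ → ℕ → V) (e : ℕ → ℕ → ι) (u b : V)
    (hw0 : ∀ t, t < r → w t 0 = u) (hwL : ∀ t, t < r → w t (L t) = b)
    (harc : ∀ t, t < r → ∀ j, 1 ≤ j → j ≤ L t → ends (e t j) = s(w t (j - 1), w t j))
    (hwinj : ∀ t, t < r → ∀ i j, i ≤ L t → j ≤ L t → w t i = w t j → i = j)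
    (hcross : ∀ t t', t < r → t' < r → t ≠ t' → ∀ i j, i ≤ L t → j ≤ L t' → w t i = w t' j → (i = 0 ∧ j = 0) ∨ (i = L t ∧ j = L t'))
    (A : ℕ → Finset ι) (hA : ∀ t, t < r → ∀ i, i ∈ A t ↔ ∃ j, 1 ≤ j ∧ j ≤ L t ∧ e t j = i)
    (hAdisj : ∀ t t', t < r → t' < r → t ≠ t' → Disjoint (A t) (A t'))
    (E : Finset ι) (hEA : ∀ i, i ∈ E ↔ ∃ t, t < r ∧ i ∈ A t)
    (p q : ℕ) (hp : p < r) (hq : q < r) (hpq : p ≠ q) (t₀ : ℕ) (ht₀ : t₀ < r) (ht₀p : t₀ ≠ p) (ht₀q : t₀ ≠ q)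
    (hthree : ∀ t, t < r → t = p ∨ t = q ∨ t = t₀) (hL2 : L t₀ = 2)
    (𝒱 : Finset ι → Prop) (hV : ∀ ⦃s t : Finset ι⦄, s ⊆ t → 𝒱 s → 𝒱 t)
    (h k ha hb ka kb : Set V → ℝ) (mh : Monotone h) (mk : Monotone k)
    (mha : Monotone ha) (mhb : Monotone hb) (mka : Monotone ka) (mkb : Monotone kb)
    (ha0 : ∀ S, 0 ≤ ha S) (hah : ∀ S, ha S ≤ h S) (hb0 : ∀ S, 0 ≤ hb S) (hbh : ∀ S, hb S ≤ h S)
    (ka0 : ∀ S, 0 ≤ ka S) (kak : ∀ S, ka S ≤ k S) (kb0 : ∀ S, 0 ≤ kb S) (kbk : ∀ S, kb S ≤ k S) :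
    0 ≤ (∑ ω ∈ E.powerset, if 𝒱 ω ∧ b ∈ openCluster (ends '' (↑ω : Set ι)) u ∧ b ∉ openCluster (ends '' (↑(E \ ω) : Set ι)) u then
        h (openCluster (ends '' (↑ω : Set ι)) u) * k (openCluster (ends '' (↑ω : Set ι)) u) else 0)
      + ∑ ω ∈ E.powerset, if 𝒱 ω ∧ b ∈ openCluster (ends '' (↑(E \ ω) : Set ι)) u ∧ b ∉ openCluster (ends '' (↑ω : Set ι)) u then
        (ha (openCluster (ends '' (↑ω : Set ι)) u) - hb (openCluster (ends '' (↑(E \ ω) : Set ι)) u)) *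
          (ka (openCluster (ends '' (↑ω : Set ι)) u) - kb (openCluster (ends '' (↑(E \ ω) : Set ι)) u)) else 0 := by
  set C : Finset ι → Set V := fun ω => openCluster (ends '' (↑ω : Set ι)) u with hC
  -- ### the short thread: edges f = u x, g = x b
  set f : ι := e t₀ 1 with hfdef
  set g : ι := e t₀ 2 with hgdef
  set x : V := w t₀ 1 with hxdef
  set E' : Finset ι := A p ∪ A q with hE'
  have hL1 : 1 ≤ L t₀ := by rw [hL2]; omega
  have hf : ends f = s(u, x) := by
    have := harc t₀ ht₀ 1 (le_refl _) (by rw [hL2]; omega)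
    rw [hw0 t₀ ht₀] at this; exact this
  have hg : ends g = s(x, b) := by
    have := harc t₀ ht₀ 2 (by omega) (by rw [hL2])
    rw [← hL2, hwL t₀ ht₀] at this
    rw [hL2] at this; exact this
  have hxu : x ≠ u := by
    intro hxu
    have := hwinj t₀ ht₀ 1 0 (by rw [hL2]; omega) (Nat.zero_le _) (hxu.trans (hw0 t₀ ht₀).symm); omega
  have hxb : x ≠ b := by
    intro hxb
    have := hwinj t₀ ht₀ 1 (L t₀) (by rw [hL2]; omega) (le_refl _) (hxb.trans (hwL t₀ ht₀).symm); omega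
  have hbx : b ≠ x := fun h => hxb h.symm
  have hub : u ≠ b := by
    intro hub
    have := hwinj t₀ ht₀ 0 (L t₀) (Nat.zero_le _) (le_refl _) ((hw0 t₀ ht₀).trans (hub.trans (hwL t₀ ht₀).symm)); omega
  have hfg : f ≠ g := by
    intro hfg
    have := arc_edge_inj ends (L t₀) (w t₀) (e t₀) (harc t₀ ht₀) (hwinj t₀ ht₀) 1 2 (le_refl _) (by rw [hL2]; omega) (by omega)
      (by rw [hL2]) hfg
    omega
  have hAt₀ : ∀ i, i ∈ A t₀ ↔ i = f ∨ i = g := by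
    intro i
    rw [hA t₀ ht₀ i]
    constructor
    · rintro ⟨j, hj1, hjL, rfl⟩
      rw [hL2] at hjL
      rcases Nat.lt_or_ge j 2 with hj | hj
      · left; have : j = 1 := by omega
        rw [this]
      · right; have : j = 2 := by omega
        rw [this]
    · rintro (rfl | rfl)
      · exact ⟨1, le_refl _, hL1, rfl⟩
      · exact ⟨2, by omega, by rw [hL2], rfl⟩
  have hfA : f ∈ A t₀ := (hAt₀ f).mpr (Or.inl rfl)
  have hgA : g ∈ A t₀ := (hAt₀ g).mpr (Or.inr rfl)
  have hfE' : f ∉ E' := by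
    intro hf'
    rcases Finset.mem_union.mp hf' with h' | h'
    · exact Finset.disjoint_left.mp (hAdisj t₀ p ht₀ hp ht₀p) hfA h'
    · exact Finset.disjoint_left.mp (hAdisj t₀ q ht₀ hq ht₀q) hfA h'
  have hgE' : g ∉ E' := by
    intro hg'
    rcases Finset.mem_union.mp hg' with h' | h'
    · exact Finset.disjoint_left.mp (hAdisj t₀ p ht₀ hp ht₀p) hgA h'
    · exact Finset.disjoint_left.mp (hAdisj t₀ q ht₀ hq ht₀q) hgA h'
  have hfgE' : f ∉ insert g E' := by
    rw [Finset.mem_insert]; rintro (h' | h'); exact hfg h'; exact hfE' h'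
  have hE : E = insert f (insert g E') := by
    ext i
    rw [hEA i, Finset.mem_insert, Finset.mem_insert, hE', Finset.mem_union]
    constructor
    · rintro ⟨t, ht, hi⟩
      rcases hthree t ht with rfl | rfl | rfl
      · exact Or.inr (Or.inr (Or.inl hi))
      · exact Or.inr (Or.inr (Or.inr hi))
      · rcases (hAt₀ i).mp hi with h' | h'
        · exact Or.inl h'
        · exact Or.inr (Or.inl h')
    · rintro (rfl | rfl | hi | hi)
      · exact ⟨t₀, ht₀, hfA⟩
      · exact ⟨t₀, ht₀, hgA⟩
      · exact ⟨p, hp, hi⟩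
      · exact ⟨q, hq, hi⟩
  have hE'E : E' ⊆ E := by intro i hi; rw [hE]; exact Finset.mem_insert_of_mem (Finset.mem_insert_of_mem hi)
  have hfE : f ∈ E := by rw [hE]; exact Finset.mem_insert_self _ _
  have hgE : g ∈ E := by rw [hE]; exact Finset.mem_insert_of_mem (Finset.mem_insert_self _ _)
  -- x meets no edge of the cycle
  have hxE' : ∀ i ∈ E', x ∉ ends i := by
    intro i hi hxi
    have aux : ∀ t, t < r → t₀ ≠ t → i ∈ A t → False := by
      intro t ht hne hit
      obtain ⟨j, hj1, hjL, rfl⟩ := (hA t ht _).mp hit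
      rw [harc t ht j hj1 hjL, Sym2.mem_iff] at hxi
      rcases hxi with hx' | hx'
      · rcases hcross t₀ t ht₀ ht hne 1 (j - 1) (by rw [hL2]; omega) (by omega) hx' with ⟨h0, _⟩ | ⟨h0, _⟩
        · omega
        · rw [hL2] at h0; omega
      · rcases hcross t₀ t ht₀ ht hne 1 j (by rw [hL2]; omega) hjL hx' with ⟨h0, _⟩ | ⟨h0, _⟩
        · omega
        · rw [hL2] at h0; omega
    rcases Finset.mem_union.mp hi with hi' | hi'
    · exact aux p hp ht₀p hi'
    · exact aux q hq ht₀q hi'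
  -- ### cluster identities for the four slices (η ⊆ E′)
  have sdiff_f : ∀ η, η ⊆ E' → E \ insert f η = insert g (E' \ η) :=
    sdiff_insert_insert_f E E' f g hE hfg hfE' hgE'
  have sdiff_g : ∀ η, η ⊆ E' → E \ insert g η = insert f (E' \ η) :=
    sdiff_insert_insert_g E E' f g hE hfg hfE' hgE'
  have sdiff_0 : ∀ η, η ⊆ E' → E \ η = insert f (insert g (E' \ η)) :=
    sdiff_insert_insert_none E E' f g hE hfE' hgE'
  have sdiff_fg : ∀ η : Finset ι, E \ insert f (insert g η) = E' \ η :=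
    sdiff_insert_insert_both E E' f g hE hfE' hgE'
  have hxE'sub : ∀ η, η ⊆ E' → ∀ i ∈ η, x ∉ ends i := fun η hη i hi => hxE' i (hη hi)
  have hxE'sd : ∀ η : Finset ι, ∀ i ∈ E' \ η, x ∉ ends i := fun η i hi => hxE' i (Finset.sdiff_subset hi)
  have Cf : ∀ η, η ⊆ E' → C (insert f η) = insert x (C η) := fun η hη =>
    cluster_insert_hubEdge_u ends η f u x hf (hxE'sub η hη)
  have Cg : ∀ η, η ⊆ E' → C (insert g η) = C η ∪ {y | y = x ∧ b ∈ C η} := fun η hη =>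
    cluster_insert_hubEdge_b ends η g u b x hg hxu hxb (hxE'sub η hη)
  have Cf' : ∀ η : Finset ι, C (insert f (E' \ η)) = insert x (C (E' \ η)) := fun η =>
    cluster_insert_hubEdge_u ends (E' \ η) f u x hf (hxE'sd η)
  have Cg' : ∀ η : Finset ι, C (insert g (E' \ η)) = C (E' \ η) ∪ {y | y = x ∧ b ∈ C (E' \ η)} := fun η =>
    cluster_insert_hubEdge_b ends (E' \ η) g u b x hg hxu hxb (hxE'sd η)
  -- the thread t₀ is fully red in insert f (insert g η) and fully blue off η ⊆ E′
  have hb_fg : ∀ η : Finset ι, b ∈ C (insert f (insert g η)) := by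
    intro η
    refine bundle_b_mem_cluster_of_full ends r L w e u b hw0 hwL harc (insert f (insert g η)) t₀ ht₀ ?_
    intro j hj1 hjL
    rw [hL2] at hjL
    rcases Nat.lt_or_ge j 2 with hj | hj
    · have : j = 1 := by omega
      rw [this]; exact Finset.mem_insert_self _ _
    · have : j = 2 := by omega
      rw [this]; exact Finset.mem_insert_of_mem (Finset.mem_insert_self _ _)
  -- membership bookkeeping in the modified clusters
  have mem_union_x : ∀ (S : Set V) (P : Prop), b ∈ S ∪ {y | y = x ∧ P} ↔ b ∈ S := fun S P => mem_union_single_iff hbx S P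
  have union_x_of : ∀ (S : Set V) (P : Prop), P → S ∪ {y | y = x ∧ P} = insert x S := fun S P hP => union_single_of_pos x S P hP
  have union_x_of_not : ∀ (S : Set V) (P : Prop), ¬ P → S ∪ {y | y = x ∧ P} = S := fun S P hP => union_single_of_neg x S P hP
  have mem_insert_x : ∀ (S : Set V), b ∈ insert x S ↔ b ∈ S := fun S => mem_insert_iff_of_ne hbx S
  -- ### the summands
  set FR : Finset ι → ℝ := fun ω => if 𝒱 ω ∧ b ∈ C ω ∧ b ∉ C (E \ ω) then h (C ω) * k (C ω) else 0 with hFR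
  set FD : Finset ι → ℝ := fun ω => if 𝒱 ω ∧ b ∈ C (E \ ω) ∧ b ∉ C ω then
      (ha (C ω) - hb (C (E \ ω))) * (ka (C ω) - kb (C (E \ ω))) else 0 with hFD
  change 0 ≤ (∑ ω ∈ E.powerset, FR ω) + ∑ ω ∈ E.powerset, FD ω
  -- splitting the sums over the colours of f and g
  have split : ∀ F : Finset ι → ℝ, ∑ ω ∈ E.powerset, F ω =
      (∑ η ∈ E'.powerset, F η) + (∑ η ∈ E'.powerset, F (insert g η)) +
        ((∑ η ∈ E'.powerset, F (insert f η)) + ∑ η ∈ E'.powerset, F (insert f (insert g η))) := by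
    intro F
    rw [hE, Finset.sum_powerset_insert hfgE', Finset.sum_powerset_insert hgE', Finset.sum_powerset_insert hgE']
  rw [split FR, split FD]
  -- ### (1) vanishing terms: no supply when the short thread is blue, no demand when it is red
  have zR : ∑ η ∈ E'.powerset, FR η = 0 := by
    apply Finset.sum_eq_zero
    intro η hη
    rw [Finset.mem_powerset] at hη
    have hbY : b ∈ C (E \ η) := by rw [sdiff_0 η hη]; exact hb_fg _
    simp only [hFR]
    rw [if_neg]
    rintro ⟨_, _, hn⟩; exact hn hbY
  have zD : ∑ η ∈ E'.powerset, FD (insert f (insert g η)) = 0 := by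
    apply Finset.sum_eq_zero
    intro η _
    simp only [hFD]
    rw [if_neg]
    rintro ⟨_, _, hn⟩; exact hn (hb_fg η)
  -- ### (2) boundary slices: THEOREM BI
  have bi := iet_boundary_bundle ends r L hL w e u b hw0 hwL harc hwinj hcross A hA hAdisj E hEA p q hp hq hpq t₀ ht₀ ht₀p ht₀q
    𝒱 hV h k ha hb ka kb mh mk mha mhb mka mkb ha0 hah hb0 hbh ka0 kak kb0 kbk
  have hO : E \ (A p ∪ A q) = insert f (insert g ∅) := by
    rw [← hE']; exact sdiff_insert_insert_self E E' f g hE hfE' hgE'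
  have biR : (∑ ω ∈ E.powerset, if (𝒱 ω ∧ E \ (A p ∪ A q) ⊆ ω) ∧ (b ∈ C ω ∧ b ∉ C (E \ ω)) then h (C ω) * k (C ω) else 0) =
      ∑ η ∈ E'.powerset, FR (insert f (insert g η)) := by
    rw [split]
    have e1 : ∑ η ∈ E'.powerset, (if (𝒱 η ∧ E \ (A p ∪ A q) ⊆ η) ∧ (b ∈ C η ∧ b ∉ C (E \ η)) then h (C η) * k (C η) else 0) = 0 := by
      apply Finset.sum_eq_zero; intro η hη; rw [Finset.mem_powerset] at hη
      rw [if_neg]; rintro ⟨⟨_, hs⟩, _⟩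
      exact hfE' (hη (hs (by rw [hO]; exact Finset.mem_insert_self _ _)))
    have e2 : ∑ η ∈ E'.powerset, (if (𝒱 (insert g η) ∧ E \ (A p ∪ A q) ⊆ insert g η) ∧ (b ∈ C (insert g η) ∧ b ∉ C (E \ insert g η))
        then h (C (insert g η)) * k (C (insert g η)) else 0) = 0 := by
      apply Finset.sum_eq_zero; intro η hη; rw [Finset.mem_powerset] at hη
      rw [if_neg]; rintro ⟨⟨_, hs⟩, _⟩
      have := hs (by rw [hO]; exact Finset.mem_insert_self _ _)
      rw [Finset.mem_insert] at this
      rcases this with h' | h'; exact hfg h'; exact hfE' (hη h')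
    have e3 : ∑ η ∈ E'.powerset, (if (𝒱 (insert f η) ∧ E \ (A p ∪ A q) ⊆ insert f η) ∧ (b ∈ C (insert f η) ∧ b ∉ C (E \ insert f η))
        then h (C (insert f η)) * k (C (insert f η)) else 0) = 0 := by
      apply Finset.sum_eq_zero; intro η hη; rw [Finset.mem_powerset] at hη
      rw [if_neg]; rintro ⟨⟨_, hs⟩, _⟩
      have := hs (by rw [hO]; exact Finset.mem_insert_of_mem (Finset.mem_insert_self _ _))
      rw [Finset.mem_insert] at this
      rcases this with h' | h'; exact hfg h'.symm; exact hgE' (hη h')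
    rw [e1, e2, e3]
    simp only [zero_add]
    apply Finset.sum_congr rfl
    intro η _
    simp only [hFR]
    apply ite_zero_congr _ (fun _ => rfl)
    constructor
    · rintro ⟨⟨hv, _⟩, hc⟩; exact ⟨hv, hc⟩
    · rintro ⟨hv, hc⟩
      refine ⟨⟨hv, ?_⟩, hc⟩
      rw [hO]; intro i hi
      rw [Finset.mem_insert, Finset.mem_insert] at hi
      rcases hi with rfl | rfl | hi
      · exact Finset.mem_insert_self _ _
      · exact Finset.mem_insert_of_mem (Finset.mem_insert_self _ _)
      · exact absurd hi (Finset.notMem_empty _)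
  have biD : (∑ ω ∈ E.powerset, if (𝒱 ω ∧ ω ⊆ A p ∪ A q) ∧ (b ∈ C (E \ ω) ∧ b ∉ C ω) then
        (ha (C ω) - hb (C (E \ ω))) * (ka (C ω) - kb (C (E \ ω))) else 0) = ∑ η ∈ E'.powerset, FD η := by
    rw [split]
    have e2 : ∑ η ∈ E'.powerset, (if (𝒱 (insert g η) ∧ insert g η ⊆ A p ∪ A q) ∧ (b ∈ C (E \ insert g η) ∧ b ∉ C (insert g η)) then
        (ha (C (insert g η)) - hb (C (E \ insert g η))) * (ka (C (insert g η)) - kb (C (E \ insert g η))) else 0) = 0 := by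
      apply Finset.sum_eq_zero; intro η _
      rw [if_neg]; rintro ⟨⟨_, hs⟩, _⟩; exact hgE' (hs (Finset.mem_insert_self _ _))
    have e3 : ∑ η ∈ E'.powerset, (if (𝒱 (insert f η) ∧ insert f η ⊆ A p ∪ A q) ∧ (b ∈ C (E \ insert f η) ∧ b ∉ C (insert f η)) then
        (ha (C (insert f η)) - hb (C (E \ insert f η))) * (ka (C (insert f η)) - kb (C (E \ insert f η))) else 0) = 0 := by
      apply Finset.sum_eq_zero; intro η _
      rw [if_neg]; rintro ⟨⟨_, hs⟩, _⟩; exact hfE' (hs (Finset.mem_insert_self _ _))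
    have e4 : ∑ η ∈ E'.powerset, (if (𝒱 (insert f (insert g η)) ∧ insert f (insert g η) ⊆ A p ∪ A q) ∧
        (b ∈ C (E \ insert f (insert g η)) ∧ b ∉ C (insert f (insert g η))) then
        (ha (C (insert f (insert g η))) - hb (C (E \ insert f (insert g η)))) *
          (ka (C (insert f (insert g η))) - kb (C (E \ insert f (insert g η)))) else 0) = 0 := by
      apply Finset.sum_eq_zero; intro η _
      rw [if_neg]; rintro ⟨⟨_, hs⟩, _⟩; exact hfE' (hs (Finset.mem_insert_self _ _))
    rw [e2, e3, e4, add_zero, add_zero, add_zero]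
    apply Finset.sum_congr rfl
    intro η hη
    rw [Finset.mem_powerset] at hη
    simp only [hFD]
    apply ite_zero_congr _ (fun _ => rfl)
    constructor
    · rintro ⟨⟨hv, _⟩, hc⟩; exact ⟨hv, hc⟩
    · rintro ⟨hv, hc⟩; exact ⟨⟨hv, hη⟩, hc⟩
  have boundary : 0 ≤ (∑ η ∈ E'.powerset, FD η) + ∑ η ∈ E'.powerset, FR (insert f (insert g η)) := by
    rw [← biR, ← biD, add_comm]; exact bi
  -- ### (3) the cycle data of threads p, q
  have heinjp := arc_edge_inj ends (L p) (w p) (e p) (harc p hp) (hwinj p hp)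
  have heinjq := arc_edge_inj ends (L q) (w q) (e q) (harc q hq) (hwinj q hq)
  have hmono_ins : ∀ (φ : Set V → ℝ), Monotone φ → Monotone (fun S : Set V => φ (insert x S)) :=
    fun φ hφ S T hST => hφ (Set.insert_subset_insert hST)
  -- ### (4) slice f red, g blue: the cycle IET with all levels shifted by x
  have slice_f : 0 ≤ (∑ η ∈ E'.powerset, FR (insert f η)) + ∑ η ∈ E'.powerset, FD (insert f η) := by
    have cyc := iet_cycle ends (L p) (L q) (hL p hp) (hL q hq) (w p) (w q) (e p) (e q) u b
      (hw0 p hp) (hwL p hp) (hw0 q hq) (hwL q hq) (harc p hp) (harc q hq) (hwinj p hp) (hwinj q hq) heinjp heinjq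
      (hcross p q hp hq hpq) (A p) (A q) (hA p hp) (hA q hq) (hAdisj p q hp hq hpq)
      (fun η => 𝒱 (insert f η)) (fun s t hst hs => hV (Finset.insert_subset_insert f hst) hs)
      (fun S => h (insert x S)) (fun S => k (insert x S)) (fun S => ha (insert x S)) (fun S => hb (insert x S))
      (fun S => ka (insert x S)) (fun S => kb (insert x S))
      (hmono_ins h mh) (hmono_ins k mk) (hmono_ins ha mha) (hmono_ins hb mhb) (hmono_ins ka mka) (hmono_ins kb mkb)
      (fun S => ha0 _) (fun S => hah _) (fun S => hb0 _) (fun S => hbh _)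
      (fun S => ka0 _) (fun S => kak _) (fun S => kb0 _) (fun S => kbk _)
    rw [← hE'] at cyc
    have eR : (∑ η ∈ E'.powerset, if 𝒱 (insert f η) ∧ b ∈ C η ∧ b ∉ C (E' \ η) then h (insert x (C η)) * k (insert x (C η)) else 0) =
        ∑ η ∈ E'.powerset, FR (insert f η) := by
      apply Finset.sum_congr rfl
      intro η hη
      rw [Finset.mem_powerset] at hη
      simp only [hFR]
      apply ite_zero_congr
      · rw [sdiff_f η hη, Cf η hη, Cg' η, mem_insert_x, mem_union_x]
      · intro _; rw [Cf η hη]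
    have eD : (∑ η ∈ E'.powerset, if 𝒱 (insert f η) ∧ b ∈ C (E' \ η) ∧ b ∉ C η then
          (ha (insert x (C η)) - hb (insert x (C (E' \ η)))) * (ka (insert x (C η)) - kb (insert x (C (E' \ η)))) else 0) =
        ∑ η ∈ E'.powerset, FD (insert f η) := by
      apply Finset.sum_congr rfl
      intro η hη
      rw [Finset.mem_powerset] at hη
      simp only [hFD]
      apply ite_zero_congr
      · rw [sdiff_f η hη, Cf η hη, Cg' η, mem_insert_x, mem_union_x]
      · intro hq
        have hbY : b ∈ C (E' \ η) := by
          have := hq.2.1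
          rwa [sdiff_f η hη, Cg' η, mem_union_x] at this
        rw [sdiff_f η hη, Cg' η, union_x_of _ _ hbY, Cf η hη]
    rw [← eR, ← eD]; exact cyc
  -- ### (5) slice g red, f blue: the cycle IET with h, k, hᵇ, kᵇ shifted by x
  have slice_g : 0 ≤ (∑ η ∈ E'.powerset, FR (insert g η)) + ∑ η ∈ E'.powerset, FD (insert g η) := by
    have cyc := iet_cycle ends (L p) (L q) (hL p hp) (hL q hq) (w p) (w q) (e p) (e q) u b
      (hw0 p hp) (hwL p hp) (hw0 q hq) (hwL q hq) (harc p hp) (harc q hq) (hwinj p hp) (hwinj q hq) heinjp heinjq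
      (hcross p q hp hq hpq) (A p) (A q) (hA p hp) (hA q hq) (hAdisj p q hp hq hpq)
      (fun η => 𝒱 (insert g η)) (fun s t hst hs => hV (Finset.insert_subset_insert g hst) hs)
      (fun S => h (insert x S)) (fun S => k (insert x S)) ha (fun S => hb (insert x S)) ka (fun S => kb (insert x S))
      (hmono_ins h mh) (hmono_ins k mk) mha (hmono_ins hb mhb) mka (hmono_ins kb mkb)
      ha0 (fun S => (hah S).trans (mh (Set.subset_insert x S))) (fun S => hb0 _) (fun S => hbh _)
      ka0 (fun S => (kak S).trans (mk (Set.subset_insert x S))) (fun S => kb0 _) (fun S => kbk _)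
    rw [← hE'] at cyc
    have eR : (∑ η ∈ E'.powerset, if 𝒱 (insert g η) ∧ b ∈ C η ∧ b ∉ C (E' \ η) then h (insert x (C η)) * k (insert x (C η)) else 0) =
        ∑ η ∈ E'.powerset, FR (insert g η) := by
      apply Finset.sum_congr rfl
      intro η hη
      rw [Finset.mem_powerset] at hη
      simp only [hFR]
      apply ite_zero_congr
      · rw [sdiff_g η hη, Cg η hη, Cf' η, mem_union_x, mem_insert_x]
      · intro hq
        have hbX : b ∈ C η := by
          have := hq.2.1
          rwa [Cg η hη, mem_union_x] at this
        rw [Cg η hη, union_x_of _ _ hbX]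
    have eD : (∑ η ∈ E'.powerset, if 𝒱 (insert g η) ∧ b ∈ C (E' \ η) ∧ b ∉ C η then
          (ha (C η) - hb (insert x (C (E' \ η)))) * (ka (C η) - kb (insert x (C (E' \ η)))) else 0) =
        ∑ η ∈ E'.powerset, FD (insert g η) := by
      apply Finset.sum_congr rfl
      intro η hη
      rw [Finset.mem_powerset] at hη
      simp only [hFD]
      apply ite_zero_congr
      · rw [sdiff_g η hη, Cg η hη, Cf' η, mem_union_x, mem_insert_x]
      · intro hq
        have hbn : b ∉ C η := by
          have := hq.2.2
          rwa [Cg η hη, mem_union_x] at this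
        rw [Cg η hη, union_x_of_not _ _ hbn, sdiff_g η hη, Cf' η]
    rw [← eR, ← eD]; exact cyc
  -- ### (6) assembly
  rw [zR, zD]
  linarith [boundary, slice_f, slice_g]

end Coefficientwise

end Summit.CriticalPhenomena.PercolationContinuityZ3.Theorems
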